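import Literature.AlgebraicGeometry.Resolution.BlowupChartRegular
import Literature.AlgebraicGeometry.Resolution.RegularLocalRingsQuotient
import Literature.AlgebraicGeometry.Resolution.RegularCentreLocal
import Literature.AlgebraicGeometry.Resolution.DerivativeIdealsLocalization
import Mathlib.Algebra.MvPolynomial.PDeriv
import HarnessLib

/-!
# The controlled transform of a maximal-contact parameter is a parameter (BGMW 2011, Lemma 3.6.4 (4), chart form)

Topic: `Literature/AlgebraicGeometry/Resolution`. Bierstone–Grigoriev–Milman–Włodarczyk, *Effective
Hironaka resolution and its complexity (with appendix on applications in positive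
characteristic)*, arXiv:1206.3090, §3.6, **Lemma 3.6.4 (4)** (Giraud): for a blow-up
`σ : X' → X` at a smooth centre `C` and a function `u` of order one along `V(u) ⊇ C`, on an open
`U'` where the exceptional divisor is described by `y`, the controlled transform
`u' := σᶜ(u) = y⁻¹σ^*(u)` defines a smooth hypersurface `V(u')` — printed proof: "(2) Since `u`
is one of the local parameters describing the center of the blow-up, `u' = u/y` is a parameter;
that is, a function of order one."

This file PROVES the statement on the CHARTS of the blow-up along a quasi-regular sequence
`x = (x_1, …, x_r)` (`I = (x)`; `AffineBlowup.lean`, `BlowupChartQuasiRegular.lean`): on the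
chart `B = (R[It])_{(x_i t)} = R[I/x_i]`, with `y = x_i` the equation of the exceptional divisor
and `u = x_j` one of the parameters of the centre, the controlled transform of `u` is the chart
generator `e_j = (x_j t)/(x_i t) = x_j/x_i`, and:

* `notMem_sq_maximalIdeal_of_surjective_mvPolynomial` — the algebra behind it, for EVERY ring:
  if `ψ : R[T] → S` is a surjection from a polynomial ring whose kernel lies in `K·R[T]` for an
  ideal `K ⊆ R`, and `Q` is a prime of `S` containing `ψ(K)`, then `ψ(T_j)` is of order exactly
  one at `Q`: `ψ(T_j) ∉ 𝔪_Q² ⊆ S_Q`. Proof: lift to `R[T]_{Q'}`, `Q' = ψ⁻¹Q`, where `∂/∂T_j`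
  (extended to the localization) maps `𝔪²` into `𝔪` and `K·R[T]_{Q'}` into itself, hence into
  `𝔪`, but `T_j` to `1`; auxiliary: `Derivation.apply_mem_of_mem_pow_two` (`D(P²) ⊆ P`),
  `Derivation.apply_mem_span_of_forall` (a derivation preserves `span G` once it maps `G` into it),
  `MvPolynomial.pderiv_mem_map_C` (`∂/∂T_j` preserves `K·R[T]`);
* `chartGen_notMem_sq` — for `x` quasi-regular: at every prime `Q` of the chart ring on the
  exceptional divisor (`x_i ∈ Q`), `e_j ∉ 𝔪_Q²` (the chart ring is `R[T_l : l ≠ i]` modulo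
  relations lying in `I·R[T]`, `ker_quotient_comp_eval₂Hom_eq`, and `ψ(I) ⊆ (x_i) ⊆ Q`);
* `notMem_sq_maximalIdeal_of_pderiv_notMem` — the same for any `p ∈ R[T]` with `ψ(∂p/∂T_j) ∉ Q`
  in place of `T_j`;
* `chartTransform_notMem_sq`, `isRegularLocalRing_quotient_chartTransform` — the versions for a
  GENERAL parameter `u = Σ a_l x_l ∈ I` of order one at the point `𝔭 = φ⁻¹Q` below: its
  controlled transform `û = Σ φ(a_l) e_l` (`φ(u) = φ(x_i)·û`, `reesChartBase_sum_mul_eq`) is of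
  order one wherever it vanishes on the exceptional divisor (some `a_l`, `l ≠ i`, is a unit at
  `𝔭`, and `∂/∂T_l` of the linear form lifting `û` is that unit);
* `notMem_map_of_pderiv_notMem`, `exists_chartTransform_presentation`,
  `chartTransform_notMem_span_exceptional`, `reesChartBase_notMem_span_chartTransform` — the
  relative versions: `û ∉ (x_i)·B_Q` and (for `R/I` regular) `x_i ∉ (û)·B_Q`, i.e. `V(û)` and the
  exceptional divisor have no common component through `Q` (input for the Cartier condition in
  the restriction property, Lemma 3.6.4 (6));
* `isRegularLocalRing_quotient_chartGen` — **Lemma 3.6.4 (4) on the charts, at the points of the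
  exceptional divisor**: if moreover `R` and `R/I` are regular rings (the blow-up of a regular
  scheme along a regular centre), then `B_Q` is a regular local ring (`isRegularRing_blowupChart`)
  and, for `e_j ∈ Q`, `B_Q/(e_j)` is a regular local ring with `dim B_Q/(e_j) + 1 = dim B_Q`
  (Matsumura Thm. 14.2, `IsRegularLocalRing.quotient_span_singleton`): the hypersurface
  `V(u') = V(e_j)` is regular of codimension one at `Q`.

(Off the exceptional divisor the blow-up is a local isomorphism and `V(u') = σ⁻¹V(u)`; the
sheaf-level assembly for `IsBlowup` is left to a later file, cf. `MaximalContactPersistence.lean`.)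

## Sources

* [BGMW 2011] §3.6 Lemma 3.6.4 (4) and its proof (arXiv:1206.3090, p. 8).
  [BierstoneGrigorievMilmanWlodarczyk2011]
* H. Matsumura, *Commutative Ring Theory* (1986), Thm. 14.2 — through
  `RegularLocalRingsQuotient.lean`. [Matsumura1987]
* The Stacks Project, Tag 0BIQ (charts of the blow-up of a regular sequence) — through
  `BlowupChartQuasiRegular.lean`. [StacksProject]
-/

noncomputable section

open IsLocalRing HomogeneousLocalization

namespace Literature.AlgebraicGeometry.Resolution

universe u v w

/-! ## Derivations and ideals -/

/-- A derivation (over any base ring `k`) maps the square of an ideal into the ideal (Leibniz);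
the case `k = ℤ` is `Derivation.apply_mem_of_mem_sq` (`JacobianRegularLocus.lean`). [folklore] -/
theorem Derivation.apply_mem_of_mem_pow_two {k : Type v} {A : Type u} [CommRing k] [CommRing A]
    [Algebra k A] (D : Derivation k A A) (P : Ideal A) {z : A} (hz : z ∈ P ^ 2) : D z ∈ P := by
  rw [pow_two] at hz
  refine Submodule.mul_induction_on hz (fun a ha b hb => ?_) fun y w hy hw => by
    rw [map_add]; exact P.add_mem hy hw
  rw [Derivation.leibniz, smul_eq_mul, smul_eq_mul]
  exact P.add_mem (P.mul_mem_right (D b) ha) (P.mul_mem_right (D a) hb)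

/-- A derivation preserves the ideal generated by `G` as soon as it maps `G` into it. [folklore] -/
theorem Derivation.apply_mem_span_of_forall {k : Type v} {A : Type u} [CommRing k] [CommRing A]
    [Algebra k A] (D : Derivation k A A) {G : Set A} (hG : ∀ g ∈ G, D g ∈ Ideal.span G) {z : A}
    (hz : z ∈ Ideal.span G) : D z ∈ Ideal.span G := by
  induction hz using Submodule.span_induction with
  | mem g hg => exact hG g hg
  | zero => rw [map_zero]; exact Submodule.zero_mem _
  | add y w _ _ hy hw => rw [map_add]; exact Ideal.add_mem _ hy hw
  | smul a y hy' hy =>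
    rw [smul_eq_mul, Derivation.leibniz, smul_eq_mul, smul_eq_mul]
    exact Ideal.add_mem _ (Ideal.mul_mem_left _ _ hy) (Ideal.mul_mem_right (D a) (I := Ideal.span G) hy')

/-- `∂/∂T_j` preserves the ideal `K·R[T]` of a polynomial ring. [folklore] -/
theorem MvPolynomial.pderiv_mem_map_C {R : Type u} [CommRing R] {σ : Type v} (j : σ) (K : Ideal R)
    {p : MvPolynomial σ R} (hp : p ∈ Ideal.map (MvPolynomial.C (σ := σ)) K) :
    MvPolynomial.pderiv j p ∈ Ideal.map (MvPolynomial.C (σ := σ)) K := by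
  refine Derivation.apply_mem_span_of_forall (MvPolynomial.pderiv j) (fun g hg => ?_) hp
  obtain ⟨a, -, rfl⟩ := hg
  rw [MvPolynomial.pderiv_C]
  exact Submodule.zero_mem _

/-! ## A variable stays of order one under a surjection with relations in `K·R[T]` -/

/-- **The image of a polynomial with a unit partial derivative is of order at most one**: let
`ψ : R[T] → S` be a surjective ring map from a polynomial ring with `ker ψ ⊆ K·R[T]` for an ideal
`K ⊆ R`, `Q` a prime of `S` with `ψ(K) ⊆ Q`, and `p ∈ R[T]` with `ψ(∂p/∂T_j) ∉ Q`. Then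
`ψ(p) ∉ 𝔪_Q²` in the local ring `S_Q`. Proof: in `R[T]_{Q'}`, `Q' = ψ⁻¹(Q)`, a preimage of `ψ(p)`
in `𝔪_{Q'}²` differs from `p` by an element of `K·R[T]_{Q'}`; the derivation `∂/∂T_j` maps
`𝔪_{Q'}²` and `K·R[T]_{Q'}` into `𝔪_{Q'}` but `p` to a unit. [folklore] -/
theorem notMem_sq_maximalIdeal_of_pderiv_notMem {R : Type u} {S : Type w} [CommRing R]
    [CommRing S] {σ : Type v} (ψ : MvPolynomial σ R →+* S) (hψ : Function.Surjective ψ)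
    (K : Ideal R) (hker : RingHom.ker ψ ≤ Ideal.map MvPolynomial.C K) (Q : Ideal S) [Q.IsPrime]
    (hKQ : ∀ a ∈ K, ψ (MvPolynomial.C a) ∈ Q) (j : σ) (p : MvPolynomial σ R)
    (hp : ψ (MvPolynomial.pderiv j p) ∉ Q) :
    algebraMap S (Localization.AtPrime Q) (ψ p) ∉
      (maximalIdeal (Localization.AtPrime Q)) ^ 2 := by
  classical
  intro hmem
  -- notation
  let P := MvPolynomial σ R
  let Q' : Ideal P := Q.comap ψ
  let L' := Localization.AtPrime Q'
  let L := Localization.AtPrime Q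
  let g : L' →+* L := Localization.localRingHom Q' Q ψ rfl
  have hg : ∀ p : P, g (algebraMap P L' p) = algebraMap S L (ψ p) := fun p =>
    Localization.localRingHom_to_map Q' Q ψ rfl p
  -- `g` is surjective
  have hgs : Function.Surjective g := by
    intro y
    obtain ⟨⟨b, s⟩, rfl⟩ := IsLocalization.mk'_surjective Q.primeCompl y
    obtain ⟨p, rfl⟩ := hψ b
    obtain ⟨t, ht⟩ := hψ s
    have ht' : t ∈ Q'.primeCompl := by
      change t ∉ Q.comap ψ
      rw [Ideal.mem_comap, ht]
      exact s.2
    refine ⟨IsLocalization.mk' L' p ⟨t, ht'⟩, ?_⟩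
    rw [Localization.localRingHom_mk']
    congr 1
    exact Subtype.ext ht
  -- `𝔪_L ⊆ g(𝔪_{L'})`
  have hmax : maximalIdeal L ≤ (maximalIdeal L').map g := by
    intro y hy
    obtain ⟨z, rfl⟩ := hgs y
    by_cases hz : z ∈ maximalIdeal L'
    · exact Ideal.mem_map_of_mem g hz
    · exfalso
      rw [IsLocalRing.mem_maximalIdeal, mem_nonunits_iff, not_not] at hz
      exact (IsLocalRing.mem_maximalIdeal _).mp hy (hz.map g)
  -- a preimage `z ∈ 𝔪_{L'}²` of `ψ(p)`
  have hmem' : algebraMap S L (ψ p) ∈ (maximalIdeal L' ^ 2).map g := by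
    rw [Ideal.map_pow]
    exact Ideal.pow_right_mono hmax 2 hmem
  obtain ⟨z, hz, hzj⟩ := (Ideal.mem_map_iff_of_surjective g hgs).mp hmem'
  -- `w = p/1`; `g (w - z) = 0`
  set w : L' := algebraMap P L' p with hwdef
  have hgw : g (w - z) = 0 := by rw [map_sub, hg, hzj, sub_self]
  -- hence `w - z ∈ K·R[T]_{Q'}`
  let KP : Ideal P := Ideal.map MvPolynomial.C K
  have hdiff : w - z ∈ KP.map (algebraMap P L') := by
    obtain ⟨⟨p, t⟩, hpt⟩ := IsLocalization.mk'_surjective Q'.primeCompl (w - z)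
    have h0 : g (IsLocalization.mk' L' p t) = 0 := by
      change g ((fun y : P × Q'.primeCompl => IsLocalization.mk' L' y.1 y.2) (p, t)) = 0
      rw [hpt, hgw]
    change Localization.localRingHom Q' Q ψ rfl (IsLocalization.mk' L' p t) = 0 at h0
    rw [Localization.localRingHom_mk'] at h0
    obtain ⟨m, hm⟩ := (IsLocalization.mk'_eq_zero_iff _ _).mp h0
    obtain ⟨t', ht'⟩ := hψ m
    have ht'Q : t' ∈ Q'.primeCompl := by
      change t' ∉ Q.comap ψ
      rw [Ideal.mem_comap, ht']
      exact m.2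
    have hker' : t' * p ∈ KP := by
      apply hker
      rw [RingHom.mem_ker, map_mul, ht']
      exact hm
    -- `w - z = (t' p) · (1 / (t' t))`
    have : w - z = algebraMap P L' (t' * p) * IsLocalization.mk' L' 1 (⟨t', ht'Q⟩ * t) := by
      rw [← hpt, ← IsLocalization.mk'_eq_mul_mk'_one, IsLocalization.mk'_eq_iff_eq]
      simp only [Submonoid.coe_mul]
      congr 1
      ring
    rw [this]
    exact Ideal.mul_mem_right _ _ (Ideal.mem_map_of_mem _ hker')
  -- the derivation `∂/∂T_j` on `R[T]_{Q'}`
  obtain ⟨δ, hδ⟩ := exists_derivation_extend_of_isLocalization R L' Q'.primeCompl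
    (MvPolynomial.pderiv j : Derivation R P P)
  have hδw : IsUnit (δ w) := by
    rw [hwdef, hδ, IsLocalization.AtPrime.isUnit_to_map_iff L' Q']
    change MvPolynomial.pderiv j p ∉ Q.comap ψ
    rwa [Ideal.mem_comap]
  -- `δ` preserves `K·R[T]_{Q'}`, which lies in `𝔪_{L'}`
  have hKP' : KP.map (algebraMap P L') ≤ maximalIdeal L' := by
    rw [← Localization.AtPrime.map_eq_maximalIdeal]
    refine Ideal.map_mono ?_
    change Ideal.map MvPolynomial.C K ≤ Q.comap ψ
    rw [Ideal.map_le_iff_le_comap]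
    intro a ha
    rw [Ideal.mem_comap, Ideal.mem_comap]
    exact hKQ a ha
  have hδK : ∀ y ∈ KP.map (algebraMap P L'), δ y ∈ KP.map (algebraMap P L') := by
    intro y hy
    refine Derivation.apply_mem_span_of_forall δ (fun q hq => ?_) hy
    obtain ⟨q, hq, rfl⟩ := hq
    rw [hδ]
    exact Ideal.subset_span ⟨_, MvPolynomial.pderiv_mem_map_C j K hq, rfl⟩
  -- the unit `δ w = δ z + δ (w - z)` lies in `𝔪_{L'}`
  have h1 : δ w ∈ maximalIdeal L' := by
    rw [show w = z + (w - z) by ring, map_add]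
    exact Ideal.add_mem _ (Derivation.apply_mem_of_mem_pow_two δ _ hz) (hKP' (hδK _ hdiff))
  exact (IsLocalRing.mem_maximalIdeal _).mp h1 hδw

/-- **The image of a variable is of order one**: let `ψ : R[T] → S` be a surjective ring map from
a polynomial ring with `ker ψ ⊆ K·R[T]` for an ideal `K ⊆ R`, and `Q` a prime of `S` with
`ψ(K) ⊆ Q`. Then `ψ(T_j) ∉ 𝔪_Q²` in the local ring `S_Q` (`∂T_j/∂T_j = 1`). [folklore] -/
theorem notMem_sq_maximalIdeal_of_surjective_mvPolynomial {R : Type u} {S : Type w} [CommRing R]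
    [CommRing S] {σ : Type v} (ψ : MvPolynomial σ R →+* S) (hψ : Function.Surjective ψ)
    (K : Ideal R) (hker : RingHom.ker ψ ≤ Ideal.map MvPolynomial.C K) (Q : Ideal S) [Q.IsPrime]
    (hKQ : ∀ a ∈ K, ψ (MvPolynomial.C a) ∈ Q) (j : σ) :
    algebraMap S (Localization.AtPrime Q) (ψ (MvPolynomial.X j)) ∉
      (maximalIdeal (Localization.AtPrime Q)) ^ 2 :=
  notMem_sq_maximalIdeal_of_pderiv_notMem ψ hψ K hker Q hKQ j _ (by
    rw [MvPolynomial.pderiv_X_self, map_one]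
    exact Q.ne_top_iff_one.mp Ideal.IsPrime.ne_top')


/-- **Relative version**: under the hypotheses of `notMem_sq_maximalIdeal_of_pderiv_notMem`
(`ψ : R[T] → S` surjective with `ker ψ ⊆ K·R[T]`, `ψ(K) ⊆ Q`, `ψ(∂p/∂T_j) ∉ Q`), the image of
`ψ(p)` in `S_Q` does not lie in the ideal `K·S_Q` — e.g. `ψ(p)` does not vanish identically on
`V(K·S)` near `Q`. Same proof: `∂/∂T_j` preserves `K·R[T]_{Q'}` but maps `p` to a unit.
[folklore] -/
theorem notMem_map_of_pderiv_notMem {R : Type u} {S : Type w} [CommRing R]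
    [CommRing S] {σ : Type v} (ψ : MvPolynomial σ R →+* S) (hψ : Function.Surjective ψ)
    (K : Ideal R) (hker : RingHom.ker ψ ≤ Ideal.map MvPolynomial.C K) (Q : Ideal S) [Q.IsPrime]
    (hKQ : ∀ a ∈ K, ψ (MvPolynomial.C a) ∈ Q) (j : σ) (p : MvPolynomial σ R)
    (hp : ψ (MvPolynomial.pderiv j p) ∉ Q) :
    algebraMap S (Localization.AtPrime Q) (ψ p) ∉
      ((Ideal.map MvPolynomial.C K).map ψ).map (algebraMap S (Localization.AtPrime Q)) := by
  classical
  intro hmem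
  let P := MvPolynomial σ R
  let Q' : Ideal P := Q.comap ψ
  let L' := Localization.AtPrime Q'
  let L := Localization.AtPrime Q
  let g : L' →+* L := Localization.localRingHom Q' Q ψ rfl
  have hg : ∀ p : P, g (algebraMap P L' p) = algebraMap S L (ψ p) := fun p =>
    Localization.localRingHom_to_map Q' Q ψ rfl p
  let KP : Ideal P := Ideal.map MvPolynomial.C K
  -- `K·S_Q = g(K·R[T]_{Q'})`
  have hKim : (KP.map ψ).map (algebraMap S L) = (KP.map (algebraMap P L')).map g := by
    have hfun : (algebraMap S L).comp ψ = g.comp (algebraMap P L') :=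
      RingHom.ext fun q => (hg q).symm
    rw [Ideal.map_map, Ideal.map_map, hfun, ← Ideal.map_map, ← Ideal.map_map]
  have hgs : Function.Surjective g := by
    intro y
    obtain ⟨⟨b, s⟩, rfl⟩ := IsLocalization.mk'_surjective Q.primeCompl y
    obtain ⟨p, rfl⟩ := hψ b
    obtain ⟨t, ht⟩ := hψ s
    have ht' : t ∈ Q'.primeCompl := by
      change t ∉ Q.comap ψ
      rw [Ideal.mem_comap, ht]
      exact s.2
    refine ⟨IsLocalization.mk' L' p ⟨t, ht'⟩, ?_⟩
    rw [Localization.localRingHom_mk']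
    congr 1
    exact Subtype.ext ht
  rw [hKim] at hmem
  obtain ⟨z, hz, hzj⟩ := (Ideal.mem_map_iff_of_surjective g hgs).mp hmem
  set w : L' := algebraMap P L' p with hwdef
  have hgw : g (w - z) = 0 := by rw [map_sub, hg, hzj, sub_self]
  have hdiff : w - z ∈ KP.map (algebraMap P L') := by
    obtain ⟨⟨p, t⟩, hpt⟩ := IsLocalization.mk'_surjective Q'.primeCompl (w - z)
    have h0 : g (IsLocalization.mk' L' p t) = 0 := by
      change g ((fun y : P × Q'.primeCompl => IsLocalization.mk' L' y.1 y.2) (p, t)) = 0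
      rw [hpt, hgw]
    change Localization.localRingHom Q' Q ψ rfl (IsLocalization.mk' L' p t) = 0 at h0
    rw [Localization.localRingHom_mk'] at h0
    obtain ⟨m, hm⟩ := (IsLocalization.mk'_eq_zero_iff _ _).mp h0
    obtain ⟨t', ht'⟩ := hψ m
    have ht'Q : t' ∈ Q'.primeCompl := by
      change t' ∉ Q.comap ψ
      rw [Ideal.mem_comap, ht']
      exact m.2
    have hker' : t' * p ∈ KP := by
      apply hker
      rw [RingHom.mem_ker, map_mul, ht']
      exact hm
    have : w - z = algebraMap P L' (t' * p) * IsLocalization.mk' L' 1 (⟨t', ht'Q⟩ * t) := by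
      rw [← hpt, ← IsLocalization.mk'_eq_mul_mk'_one, IsLocalization.mk'_eq_iff_eq]
      simp only [Submonoid.coe_mul]
      congr 1
      ring
    rw [this]
    exact Ideal.mul_mem_right _ _ (Ideal.mem_map_of_mem _ hker')
  obtain ⟨δ, hδ⟩ := exists_derivation_extend_of_isLocalization R L' Q'.primeCompl
    (MvPolynomial.pderiv j : Derivation R P P)
  have hδw : IsUnit (δ w) := by
    rw [hwdef, hδ, IsLocalization.AtPrime.isUnit_to_map_iff L' Q']
    change MvPolynomial.pderiv j p ∉ Q.comap ψ
    rwa [Ideal.mem_comap]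
  have hKP' : KP.map (algebraMap P L') ≤ maximalIdeal L' := by
    rw [← Localization.AtPrime.map_eq_maximalIdeal]
    refine Ideal.map_mono ?_
    change Ideal.map MvPolynomial.C K ≤ Q.comap ψ
    rw [Ideal.map_le_iff_le_comap]
    intro a ha
    rw [Ideal.mem_comap, Ideal.mem_comap]
    exact hKQ a ha
  have hδK : ∀ y ∈ KP.map (algebraMap P L'), δ y ∈ KP.map (algebraMap P L') := by
    intro y hy
    refine Derivation.apply_mem_span_of_forall δ (fun q hq => ?_) hy
    obtain ⟨q, hq, rfl⟩ := hq
    rw [hδ]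
    exact Ideal.subset_span ⟨_, MvPolynomial.pderiv_mem_map_C j K hq, rfl⟩
  -- `w = z + (w - z) ∈ K·R[T]_{Q'}`, so the unit `δ w` lies in `𝔪_{L'}`
  have hw : w ∈ KP.map (algebraMap P L') := by
    rw [show w = z + (w - z) by ring]
    exact Ideal.add_mem _ hz hdiff
  exact (IsLocalRing.mem_maximalIdeal _).mp (hKP' (hδK _ hw)) hδw

/-! ## On the charts of the blow-up -/

section Chart

variable {R : Type u} [CommRing R] {r : ℕ} (x : Fin r → R) (i : Fin r)

local notation3 "I" => Ideal.span (Set.range x)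
local notation3 "B" => HomogeneousLocalization.Away (reesGrading I)
  (reesT (x i) (Ideal.mem_span_range_self (f := x) (x := i)))
local notation3 "φ" => reesChartBase (x i) (Ideal.mem_span_range_self (f := x) (x := i))
local notation3 "e[" j "]" =>
  HomogeneousLocalization.Away.mk (reesGrading I)
    (reesT_mem (x i) (Ideal.mem_span_range_self (f := x) (x := i))) 1
    (reesT (x j) (Ideal.mem_span_range_self (f := x) (x := j))) (reesT_mem_one_smul x j)

/-- **`u' = u/y` is of order one at the points of the exceptional divisor** (BGMW Lemma 3.6.4 (4),
chart form, for every ring `R`): for `x` quasi-regular, `j ≠ i`, and a prime `Q` of the chart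
ring `(R[It])_{(x_i t)}` with `x_i ∈ Q` (a point of the exceptional divisor), the chart generator
`e_j = (x_j t)/(x_i t)` (the controlled transform of `x_j`) is not in `𝔪_Q²`.
[cite: BierstoneGrigorievMilmanWlodarczyk2011, Lemma 3.6.4 (4)] -/
theorem chartGen_notMem_sq (hx : IsQuasiRegular x) {j : Fin r} (hji : j ≠ i) (Q : Ideal B)
    [Q.IsPrime] (hQi : φ (x i) ∈ Q) :
    (algebraMap B (Localization.AtPrime Q) : B →+* Localization.AtPrime Q) e[j] ∉
      (maximalIdeal (Localization.AtPrime Q)) ^ 2 := by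
  classical
  let ψ := MvPolynomial.eval₂Hom φ (fun j : {j : Fin r // j ≠ i} => e[j.1])
  have hψX : ψ (MvPolynomial.X ⟨j, hji⟩) = e[j] := MvPolynomial.eval₂Hom_X' _ _ _
  have hker : RingHom.ker ψ ≤ Ideal.map MvPolynomial.C I := by
    rw [← ker_quotient_comp_eval₂Hom_eq x i hx]
    intro p hp
    rw [RingHom.mem_ker] at hp ⊢
    rw [RingHom.comp_apply]
    change Ideal.Quotient.mk _ (ψ p) = 0
    rw [hp, map_zero]
  have hKQ : ∀ a ∈ I, ψ (MvPolynomial.C a) ∈ Q := by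
    intro a ha
    have h : ψ (MvPolynomial.C a) = φ a := MvPolynomial.eval₂Hom_C _ _ a
    rw [h]
    exact (Ideal.span_singleton_le_iff_mem _).mpr hQi (reesChartBase_mem_span_of_mem x i ha)
  have h := notMem_sq_maximalIdeal_of_surjective_mvPolynomial ψ (eval₂Hom_chartGen_surjective x i)
    I hker Q hKQ ⟨j, hji⟩
  rwa [hψX] at h

/-- **BGMW Lemma 3.6.4 (4) on the charts of the blow-up of a regular scheme along a regular
centre, at the points of the exceptional divisor**: if `R` is a regular ring, `x` is
quasi-regular with `R/(x)` regular, `j ≠ i`, and `Q` is a prime of the chart ring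
`B = (R[It])_{(x_i t)}` with `x_i, e_j ∈ Q`, then `B_Q` is a regular local ring, and the
hypersurface `V(e_j)` — the controlled transform `u' = u/y` of `u = x_j`, `y = x_i` — is regular
of codimension one at `Q`: `B_Q/(e_j)` is a regular local ring with `dim B_Q/(e_j) + 1 = dim B_Q`
("`u' = u/y` is a parameter; that is, a function of order one").
[cite: BierstoneGrigorievMilmanWlodarczyk2011, Lemma 3.6.4 (4)] -/
theorem isRegularLocalRing_quotient_chartGen [IsRegularRing R] (hx : IsQuasiRegular x)
    [IsRegularRing (R ⧸ I)] {j : Fin r} (hji : j ≠ i) (Q : Ideal B) [Q.IsPrime]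
    (hQi : φ (x i) ∈ Q) (hQj : e[j] ∈ Q) :
    IsRegularLocalRing (Localization.AtPrime Q) ∧
      IsRegularLocalRing (Localization.AtPrime Q ⧸ Ideal.span
        {(algebraMap B (Localization.AtPrime Q) : B →+* Localization.AtPrime Q) e[j]}) ∧
      ringKrullDim (Localization.AtPrime Q ⧸ Ideal.span
        {(algebraMap B (Localization.AtPrime Q) : B →+* Localization.AtPrime Q) e[j]}) + 1 =
          ringKrullDim (Localization.AtPrime Q) := by
  haveI : IsNoetherianRing B := isNoetherianRing_blowupChart x i
  haveI : IsRegularRing B := isRegularRing_blowupChart x i hx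
  haveI : IsRegularLocalRing (Localization.AtPrime Q) := (isRegularRing_iff.mp ‹_›) Q
  have hm : (algebraMap B (Localization.AtPrime Q) : B →+* Localization.AtPrime Q) e[j] ∈
      maximalIdeal (Localization.AtPrime Q) := by
    rw [← Localization.AtPrime.map_eq_maximalIdeal]
    exact Ideal.mem_map_of_mem _ hQj
  exact ⟨‹_›, IsRegularLocalRing.quotient_span_singleton hm (chartGen_notMem_sq x i hx hji Q hQi)⟩

/-! ## A general parameter `u ∈ I` of order one: its controlled transform `û`, `φ(u) = φ(x_i)·û` -/

/-- **The controlled transform of `u = Σ a_l x_l ∈ I` on the chart**: `φ(u) = φ(x_i) · û` with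
`û = Σ φ(a_l) e_l` (`e_l = (x_l t)/(x_i t)`, `e_i = 1`). [folklore] -/
theorem reesChartBase_sum_mul_eq (a : Fin r → R) :
    φ (∑ l, a l * x l) = φ (x i) * ∑ l, φ (a l) * e[l] := by
  rw [map_sum, Finset.mul_sum]
  refine Finset.sum_congr rfl fun l _ => ?_
  rw [map_mul, reesChartBase_apply_eq_mul_chartGen x i l]
  ring

/-- **BGMW Lemma 3.6.4 (4), chart form, for a general parameter of the centre**: let `x` be
quasi-regular, `Q` a prime of the chart ring `B = (R[It])_{(x_i t)}` on the exceptional divisor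
(`x_i ∈ Q`) over the prime `𝔭 = φ⁻¹(Q)` of `R`, and `u = Σ a_l x_l ∈ I` a function of order one
at `𝔭` (`u ∉ 𝔭²R_𝔭`). If the controlled transform `û = Σ φ(a_l) e_l` (`φ(u) = φ(x_i) û`) vanishes
at `Q`, then it is of order one there: `û ∉ 𝔪_Q²`. Proof: some coefficient `a_l`, `l ≠ i`, is a
unit at `𝔭` (otherwise `û ≡ a_i` modulo `Q`, so `a_i ∈ 𝔭` too and `u ∈ 𝔭·I ⊆ 𝔭²`), and
`∂/∂T_l` of the linear form `a_i + Σ_{l ≠ i} a_l T_l` lifting `û` to `(R/I)[T]` is that unit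
(`notMem_sq_maximalIdeal_of_pderiv_notMem`). Every ring, every characteristic.
[cite: BierstoneGrigorievMilmanWlodarczyk2011, Lemma 3.6.4 (4)] -/
theorem chartTransform_notMem_sq (hx : IsQuasiRegular x) (Q : Ideal B) [Q.IsPrime]
    (hQi : φ (x i) ∈ Q) (a : Fin r → R) (hûQ : ∑ l, φ (a l) * e[l] ∈ Q)
    (hu2 : algebraMap R (Localization.AtPrime (Q.comap φ)) (∑ l, a l * x l) ∉
      (maximalIdeal (Localization.AtPrime (Q.comap φ))) ^ 2) :
    (algebraMap B (Localization.AtPrime Q) : B →+* Localization.AtPrime Q) (∑ l, φ (a l) * e[l]) ∉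
      (maximalIdeal (Localization.AtPrime Q)) ^ 2 := by
  classical
  -- some coefficient `a_l`, `l ≠ i`, is a unit at `Q`
  have hex : ∃ l, l ≠ i ∧ φ (a l) ∉ Q := by
    by_contra hall
    push Not at hall
    apply hu2
    -- `û ≡ φ(a_i)` modulo `Q`, so `φ(a_i) ∈ Q`
    have hei : ∀ w : B, w * e[i] = w := fun w => by
      apply HomogeneousLocalization.val_injective
      rw [HomogeneousLocalization.val_mul, HomogeneousLocalization.Away.val_mk]
      have h1 : (Localization.mk (reesT (x i) (Ideal.mem_span_range_self (f := x) (x := i)))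
          ⟨reesT (x i) (Ideal.mem_span_range_self (f := x) (x := i)) ^ 1, 1, rfl⟩ :
            Localization (Submonoid.powers
              (reesT (x i) (Ideal.mem_span_range_self (f := x) (x := i))))) = 1 := by
        rw [← Localization.mk_one, Localization.mk_eq_mk_iff, Localization.r_iff_exists]
        exact ⟨1, by simp⟩
      rw [h1, mul_one]
    have hai : φ (a i) ∈ Q := by
      -- computed in `B/Q` (whose ring operations have a uniform instance path)
      have h0 : Ideal.Quotient.mk Q (∑ l, φ (a l) * e[l]) = 0 :=
        Ideal.Quotient.eq_zero_iff_mem.mpr hûQ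
      rw [map_sum, Finset.sum_eq_single i (fun l _ hl => Ideal.Quotient.eq_zero_iff_mem.mpr
        (Q.mul_mem_right _ (hall l hl))) (fun h => absurd (Finset.mem_univ i) h), hei] at h0
      exact Ideal.Quotient.eq_zero_iff_mem.mp h0
    -- hence all `a_l ∈ 𝔭 = φ⁻¹Q`, all `x_l ∈ 𝔭`, and `u ∈ 𝔭²`
    have hal : ∀ l, a l ∈ Q.comap φ := fun l => by
      by_cases hl : l = i
      · subst hl; exact hai
      · exact hall l hl
    have hxl : ∀ l, x l ∈ Q.comap φ := fun l => by
      rw [Ideal.mem_comap, reesChartBase_apply_eq_mul_chartGen x i l]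
      exact Q.mul_mem_right _ hQi
    have hu : ∑ l, a l * x l ∈ (Q.comap φ) ^ 2 := by
      rw [pow_two]
      exact Submodule.sum_mem _ fun l _ => Ideal.mul_mem_mul (hal l) (hxl l)
    have := Ideal.mem_map_of_mem (algebraMap R (Localization.AtPrime (Q.comap φ))) hu
    rwa [Ideal.map_pow, Localization.AtPrime.map_eq_maximalIdeal] at this
  obtain ⟨l₀, hl₀i, hl₀⟩ := hex
  -- the linear form `p = Σ a_l T_l` (`T_i := 1`) lifting `û`
  let ψ := MvPolynomial.eval₂Hom φ (fun j : {j : Fin r // j ≠ i} => e[j.1])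
  let T : Fin r → MvPolynomial {j : Fin r // j ≠ i} R := fun l =>
    if h : l = i then 1 else MvPolynomial.X ⟨l, h⟩
  have hψT : ∀ l, ψ (T l) = e[l] := fun l => by
    by_cases h : l = i
    · subst h
      simp only [T, dif_pos rfl, map_one, chartGen_self]
    · simp only [T, dif_neg h]
      exact MvPolynomial.eval₂Hom_X' _ _ _
  let p : MvPolynomial {j : Fin r // j ≠ i} R := ∑ l, MvPolynomial.C (a l) * T l
  have hψp : ψ p = ∑ l, φ (a l) * e[l] := by
    simp only [p, map_sum, map_mul, hψT]
    refine Finset.sum_congr rfl fun l _ => ?_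
    rw [MvPolynomial.coe_eval₂Hom, MvPolynomial.eval₂_C]
  have hpderiv : MvPolynomial.pderiv ⟨l₀, hl₀i⟩ p = MvPolynomial.C (a l₀) := by
    simp only [p, map_sum, MvPolynomial.pderiv_C_mul]
    rw [Finset.sum_eq_single l₀]
    · simp only [T, dif_neg hl₀i, MvPolynomial.pderiv_X_self, mul_one]
    · intro l _ hl
      by_cases h : l = i
      · subst h; simp only [T, dif_pos rfl, MvPolynomial.pderiv_one, mul_zero]
      · simp only [T, dif_neg h]
        rw [MvPolynomial.pderiv_X_of_ne (fun heq => hl (congrArg Subtype.val heq)), mul_zero]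
    · intro h; exact absurd (Finset.mem_univ l₀) h
  have hker : RingHom.ker ψ ≤ Ideal.map MvPolynomial.C I := by
    rw [← ker_quotient_comp_eval₂Hom_eq x i hx]
    intro q hq
    rw [RingHom.mem_ker] at hq ⊢
    rw [RingHom.comp_apply]
    change Ideal.Quotient.mk _ (ψ q) = 0
    rw [hq, map_zero]
  have hKQ : ∀ c ∈ I, ψ (MvPolynomial.C c) ∈ Q := by
    intro c hc
    have h : ψ (MvPolynomial.C c) = φ c := MvPolynomial.eval₂Hom_C _ _ c
    rw [h]
    exact (Ideal.span_singleton_le_iff_mem _).mpr hQi (reesChartBase_mem_span_of_mem x i hc)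
  have hp' : ψ (MvPolynomial.pderiv ⟨l₀, hl₀i⟩ p) ∉ Q := by
    rw [hpderiv]
    have h : ψ (MvPolynomial.C (a l₀)) = φ (a l₀) := MvPolynomial.eval₂Hom_C _ _ _
    rwa [h]
  have h := notMem_sq_maximalIdeal_of_pderiv_notMem ψ (eval₂Hom_chartGen_surjective x i) I hker
    Q hKQ ⟨l₀, hl₀i⟩ p hp'
  rwa [hψp] at h

/-- **BGMW Lemma 3.6.4 (4) on the charts of the blow-up of a regular scheme along a regular
centre, for a general parameter `u ∈ I` of the centre**: with notation and hypotheses as in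
`chartTransform_notMem_sq`, if `R` and `R/I` are regular rings then `B_Q` is a regular local
ring and the hypersurface `V(û)` of the controlled transform `û` of `u` is regular of
codimension one at `Q`: `B_Q/(û)` is a regular local ring with `dim B_Q/(û) + 1 = dim B_Q`.
[cite: BierstoneGrigorievMilmanWlodarczyk2011, Lemma 3.6.4 (4)] -/
theorem isRegularLocalRing_quotient_chartTransform [IsRegularRing R] (hx : IsQuasiRegular x)
    [IsRegularRing (R ⧸ I)] (Q : Ideal B) [Q.IsPrime] (hQi : φ (x i) ∈ Q) (a : Fin r → R)
    (hûQ : ∑ l, φ (a l) * e[l] ∈ Q)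
    (hu2 : algebraMap R (Localization.AtPrime (Q.comap φ)) (∑ l, a l * x l) ∉
      (maximalIdeal (Localization.AtPrime (Q.comap φ))) ^ 2) :
    IsRegularLocalRing (Localization.AtPrime Q) ∧
      IsRegularLocalRing (Localization.AtPrime Q ⧸ Ideal.span
        {(algebraMap B (Localization.AtPrime Q) : B →+* Localization.AtPrime Q)
          (∑ l, φ (a l) * e[l])}) ∧
      ringKrullDim (Localization.AtPrime Q ⧸ Ideal.span
        {(algebraMap B (Localization.AtPrime Q) : B →+* Localization.AtPrime Q)
          (∑ l, φ (a l) * e[l])}) + 1 = ringKrullDim (Localization.AtPrime Q) := by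
  haveI : IsNoetherianRing B := isNoetherianRing_blowupChart x i
  haveI : IsRegularRing B := isRegularRing_blowupChart x i hx
  haveI : IsRegularLocalRing (Localization.AtPrime Q) := (isRegularRing_iff.mp ‹_›) Q
  have hm : (algebraMap B (Localization.AtPrime Q) : B →+* Localization.AtPrime Q)
      (∑ l, φ (a l) * e[l]) ∈ maximalIdeal (Localization.AtPrime Q) := by
    rw [← Localization.AtPrime.map_eq_maximalIdeal]
    exact Ideal.mem_map_of_mem _ hûQ
  exact ⟨‹_›, IsRegularLocalRing.quotient_span_singleton hm
    (chartTransform_notMem_sq x i hx Q hQi a hûQ hu2)⟩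

/-- The **setup of the chart computation** for `u = Σ a_l x_l` at a prime `Q ∋ x_i` of the chart
ring over which `u` is of order one and at which the controlled transform `û = Σ φ(a_l) e_l`
vanishes: the presentation `ψ : R[T_l : l ≠ i] → B` (kernel in `I·R[T]`, `ψ(I) ⊆ Q`) together
with a linear form `p` lifting `û` whose partial derivative `∂p/∂T_{l₀} = a_{l₀}` maps outside `Q`.
[cite: BierstoneGrigorievMilmanWlodarczyk2011, Lemma 3.6.4 (4)] -/
theorem exists_chartTransform_presentation (hx : IsQuasiRegular x) (Q : Ideal B) [Q.IsPrime]
    (hQi : φ (x i) ∈ Q) (a : Fin r → R) (hûQ : ∑ l, φ (a l) * e[l] ∈ Q)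
    (hu2 : algebraMap R (Localization.AtPrime (Q.comap φ)) (∑ l, a l * x l) ∉
      (maximalIdeal (Localization.AtPrime (Q.comap φ))) ^ 2) :
    ∃ (ψ : MvPolynomial {j : Fin r // j ≠ i} R →+* B) (p : MvPolynomial {j : Fin r // j ≠ i} R)
      (l₀ : {j : Fin r // j ≠ i}),
      Function.Surjective ψ ∧ RingHom.ker ψ ≤ Ideal.map MvPolynomial.C I ∧
        (∀ c ∈ I, ψ (MvPolynomial.C c) ∈ Q) ∧ (∀ c, ψ (MvPolynomial.C c) = φ c) ∧
        ψ p = ∑ l, φ (a l) * e[l] ∧ ψ (MvPolynomial.pderiv l₀ p) ∉ Q := by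
  classical
  -- some coefficient `a_l`, `l ≠ i`, is a unit at `Q`
  have hex : ∃ l, l ≠ i ∧ φ (a l) ∉ Q := by
    by_contra hall
    push Not at hall
    apply hu2
    have hei : ∀ w : B, w * e[i] = w := fun w => by
      apply HomogeneousLocalization.val_injective
      rw [HomogeneousLocalization.val_mul, HomogeneousLocalization.Away.val_mk]
      have h1 : (Localization.mk (reesT (x i) (Ideal.mem_span_range_self (f := x) (x := i)))
          ⟨reesT (x i) (Ideal.mem_span_range_self (f := x) (x := i)) ^ 1, 1, rfl⟩ :
            Localization (Submonoid.powers
              (reesT (x i) (Ideal.mem_span_range_self (f := x) (x := i))))) = 1 := by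
        rw [← Localization.mk_one, Localization.mk_eq_mk_iff, Localization.r_iff_exists]
        exact ⟨1, by simp⟩
      rw [h1, mul_one]
    have hai : φ (a i) ∈ Q := by
      have h0 : Ideal.Quotient.mk Q (∑ l, φ (a l) * e[l]) = 0 :=
        Ideal.Quotient.eq_zero_iff_mem.mpr hûQ
      rw [map_sum, Finset.sum_eq_single i (fun l _ hl => Ideal.Quotient.eq_zero_iff_mem.mpr
        (Q.mul_mem_right _ (hall l hl))) (fun h => absurd (Finset.mem_univ i) h), hei] at h0
      exact Ideal.Quotient.eq_zero_iff_mem.mp h0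
    have hal : ∀ l, a l ∈ Q.comap φ := fun l => by
      by_cases hl : l = i
      · subst hl; exact hai
      · exact hall l hl
    have hxl : ∀ l, x l ∈ Q.comap φ := fun l => by
      rw [Ideal.mem_comap, reesChartBase_apply_eq_mul_chartGen x i l]
      exact Q.mul_mem_right _ hQi
    have hu : ∑ l, a l * x l ∈ (Q.comap φ) ^ 2 := by
      rw [pow_two]
      exact Submodule.sum_mem _ fun l _ => Ideal.mul_mem_mul (hal l) (hxl l)
    have := Ideal.mem_map_of_mem (algebraMap R (Localization.AtPrime (Q.comap φ))) hu
    rwa [Ideal.map_pow, Localization.AtPrime.map_eq_maximalIdeal] at this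
  obtain ⟨l₀, hl₀i, hl₀⟩ := hex
  let ψ := MvPolynomial.eval₂Hom φ (fun j : {j : Fin r // j ≠ i} => e[j.1])
  let T : Fin r → MvPolynomial {j : Fin r // j ≠ i} R := fun l =>
    if h : l = i then 1 else MvPolynomial.X ⟨l, h⟩
  have hψT : ∀ l, ψ (T l) = e[l] := fun l => by
    by_cases h : l = i
    · subst h
      simp only [T, dif_pos rfl, map_one, chartGen_self]
    · simp only [T, dif_neg h]
      exact MvPolynomial.eval₂Hom_X' _ _ _
  let p : MvPolynomial {j : Fin r // j ≠ i} R := ∑ l, MvPolynomial.C (a l) * T l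
  have hψC : ∀ c, ψ (MvPolynomial.C c) = φ c := fun c => MvPolynomial.eval₂Hom_C _ _ c
  have hψp : ψ p = ∑ l, φ (a l) * e[l] := by
    simp only [p, map_sum, map_mul, hψT]
    refine Finset.sum_congr rfl fun l _ => ?_
    rw [MvPolynomial.coe_eval₂Hom, MvPolynomial.eval₂_C]
  have hpderiv : MvPolynomial.pderiv ⟨l₀, hl₀i⟩ p = MvPolynomial.C (a l₀) := by
    simp only [p, map_sum, MvPolynomial.pderiv_C_mul]
    rw [Finset.sum_eq_single l₀]
    · simp only [T, dif_neg hl₀i, MvPolynomial.pderiv_X_self, mul_one]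
    · intro l _ hl
      by_cases h : l = i
      · subst h; simp only [T, dif_pos rfl, MvPolynomial.pderiv_one, mul_zero]
      · simp only [T, dif_neg h]
        rw [MvPolynomial.pderiv_X_of_ne (fun heq => hl (congrArg Subtype.val heq)), mul_zero]
    · intro h; exact absurd (Finset.mem_univ l₀) h
  have hker : RingHom.ker ψ ≤ Ideal.map MvPolynomial.C I := by
    rw [← ker_quotient_comp_eval₂Hom_eq x i hx]
    intro q hq
    rw [RingHom.mem_ker] at hq ⊢
    rw [RingHom.comp_apply]
    change Ideal.Quotient.mk _ (ψ q) = 0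
    rw [hq, map_zero]
  have hKQ : ∀ c ∈ I, ψ (MvPolynomial.C c) ∈ Q := by
    intro c hc
    rw [hψC]
    exact (Ideal.span_singleton_le_iff_mem _).mpr hQi (reesChartBase_mem_span_of_mem x i hc)
  refine ⟨ψ, p, ⟨l₀, hl₀i⟩, eval₂Hom_chartGen_surjective x i, hker, hKQ, hψC, hψp, ?_⟩
  rw [hpderiv, hψC]
  exact hl₀

/-- **The hypersurface `V(û)` does not contain the exceptional divisor near `Q`**: with notation
and hypotheses as in `chartTransform_notMem_sq`, the image of `û` in `B_Q` is not in the ideal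
`(x_i)·B_Q` of the exceptional divisor. [cite: BierstoneGrigorievMilmanWlodarczyk2011, Lemma 3.6.4 (4)] -/
theorem chartTransform_notMem_span_exceptional (hx : IsQuasiRegular x) (Q : Ideal B) [Q.IsPrime]
    (hQi : φ (x i) ∈ Q) (a : Fin r → R) (hûQ : ∑ l, φ (a l) * e[l] ∈ Q)
    (hu2 : algebraMap R (Localization.AtPrime (Q.comap φ)) (∑ l, a l * x l) ∉
      (maximalIdeal (Localization.AtPrime (Q.comap φ))) ^ 2) :
    (algebraMap B (Localization.AtPrime Q) : B →+* Localization.AtPrime Q) (∑ l, φ (a l) * e[l]) ∉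
      Ideal.span {(algebraMap B (Localization.AtPrime Q) : B →+* Localization.AtPrime Q)
        (φ (x i))} := by
  obtain ⟨ψ, p, l₀, hψs, hker, hKQ, hψC, hψp, hp⟩ :=
    exists_chartTransform_presentation x i hx Q hQi a hûQ hu2
  have h := notMem_map_of_pderiv_notMem ψ hψs I hker Q hKQ l₀ p hp
  have hIψ : (Ideal.map MvPolynomial.C I).map ψ = Ideal.span {φ (x i)} := by
    have hcomp : ψ.comp MvPolynomial.C = φ := RingHom.ext hψC
    rw [Ideal.map_map, hcomp]
    exact span_image_reesChartBase_eq (x i) (Ideal.mem_span_range_self (f := x) (x := i))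
  rwa [hIψ, hψp, Ideal.map_span, Set.image_singleton] at h

/-- **The exceptional divisor is not contained in `V(û)` near `Q` either**: with `R/I` regular
(so that `B_Q/(x_i) ≅ ((R/I)[T])_{Q̄}` is a regular local ring, a domain), `x_i ∉ (û)·B_Q` — the
two regular hypersurfaces `V(û)` and `E = V(x_i)` through `Q` have no common component, so `x_i`
stays a nonzerodivisor modulo `û` (used for: the exceptional divisor restricts to a Cartier
divisor on the transformed hypersurface). [cite: BierstoneGrigorievMilmanWlodarczyk2011, Lemma 3.6.4 (4), (6)] -/
theorem reesChartBase_notMem_span_chartTransform (hx : IsQuasiRegular x) [IsRegularRing (R ⧸ I)]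
    (Q : Ideal B) [Q.IsPrime] (hQi : φ (x i) ∈ Q) (a : Fin r → R)
    (hûQ : ∑ l, φ (a l) * e[l] ∈ Q)
    (hu2 : algebraMap R (Localization.AtPrime (Q.comap φ)) (∑ l, a l * x l) ∉
      (maximalIdeal (Localization.AtPrime (Q.comap φ))) ^ 2) :
    (algebraMap B (Localization.AtPrime Q) : B →+* Localization.AtPrime Q) (φ (x i)) ∉
      Ideal.span {(algebraMap B (Localization.AtPrime Q) : B →+* Localization.AtPrime Q)
        (∑ l, φ (a l) * e[l])} := by
  -- notation in `B_Q`
  obtain ⟨t, htdef⟩ : ∃ t : Localization.AtPrime Q,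
      t = (algebraMap B (Localization.AtPrime Q) : B →+* Localization.AtPrime Q) (φ (x i)) :=
    ⟨_, rfl⟩
  obtain ⟨v, hvdef⟩ : ∃ v : Localization.AtPrime Q,
      v = (algebraMap B (Localization.AtPrime Q) : B →+* Localization.AtPrime Q)
        (∑ l, φ (a l) * e[l]) := ⟨_, rfl⟩
  have hvt : v ∉ Ideal.span {t} := by
    rw [hvdef, htdef]
    exact chartTransform_notMem_span_exceptional x i hx Q hQi a hûQ hu2
  rw [← htdef, ← hvdef]
  intro htv
  obtain ⟨c, hc⟩ := Ideal.mem_span_singleton'.mp htv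
  -- `B_Q/(t)` is a regular local ring, hence a domain
  haveI : IsRegularRing (B ⧸ Ideal.span {φ (x i)}) := by
    obtain ⟨e⟩ := nonempty_ringEquiv_mvPolynomial_quotient_chart x i hx
    exact IsRegularRing.of_ringEquiv e
  have hJ : (Ideal.span {φ (x i)}).map
      (algebraMap B (Localization.AtPrime Q) : B →+* Localization.AtPrime Q) = Ideal.span {t} := by
    rw [Ideal.map_span, Set.image_singleton, htdef]
  haveI hregQ : IsRegularLocalRing (Localization.AtPrime Q ⧸ Ideal.span {t}) := by
    rw [← hJ]
    exact isRegularLocalRing_localization_quotient_of_le (Ideal.span {φ (x i)}) Q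
      ((Ideal.span_singleton_le_iff_mem _).mpr hQi)
  haveI : IsDomain (Localization.AtPrime Q ⧸ Ideal.span {t}) := isDomain_of_isRegularLocalRing _
  -- `c̄ v̄ = t̄ = 0` with `v̄ ≠ 0`, so `c ∈ (t)`
  have hcv : Ideal.Quotient.mk (Ideal.span {t}) c * Ideal.Quotient.mk (Ideal.span {t}) v = 0 := by
    rw [← map_mul, hc, Ideal.Quotient.eq_zero_iff_mem]
    exact Ideal.mem_span_singleton_self t
  have hv0 : Ideal.Quotient.mk (Ideal.span {t}) v ≠ 0 := fun h =>
    hvt (Ideal.Quotient.eq_zero_iff_mem.mp h)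
  have hc0 : c ∈ Ideal.span {t} :=
    Ideal.Quotient.eq_zero_iff_mem.mp ((mul_eq_zero.mp hcv).resolve_right hv0)
  obtain ⟨c', hc'⟩ := Ideal.mem_span_singleton'.mp hc0
  -- `t = c' t v`, and `t` is a nonzerodivisor: `v` is a unit, contradiction
  have ht : t ∈ nonZeroDivisors (Localization.AtPrime Q) := by
    rw [htdef]
    exact IsLocalization.nonZeroDivisors_le_comap Q.primeCompl (Localization.AtPrime Q)
      (reesChartBase_mem_nonZeroDivisors (x i) (Ideal.mem_span_range_self (f := x) (x := i)))
  have h1 : t * (1 - c' * v) = 0 := by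
    have : c' * t * v = t := by rw [hc', hc]
    linear_combination -this
  have h2 : 1 - c' * v = 0 := (mem_nonZeroDivisors_iff_right.mp ht) _ (by rw [mul_comm]; exact h1)
  have hvu : IsUnit v := isUnit_iff_exists_inv.mpr ⟨c', by linear_combination -h2⟩
  have hvm : v ∈ maximalIdeal (Localization.AtPrime Q) := by
    rw [hvdef, ← Localization.AtPrime.map_eq_maximalIdeal]
    exact Ideal.mem_map_of_mem _ hûQ
  exact (IsLocalRing.mem_maximalIdeal _).mp hvm hvu

end Chart

end Literature.AlgebraicGeometry.Resolution

end
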